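import Mathlib.GroupTheory.IndexNormal
import Mathlib.SetTheory.Cardinal.Finite
import Literature.Computability.AlgebraicComplexity.PseudoExponentBounds
import HarnessLib

/-!
# A non-normal subgroup of index `3` forces TPP capacity `≥ 4|G|/3` (Hedtke–Murthy 2012, Lemma 4.1)

Topic `Literature/Computability/AlgebraicComplexity` (group-theoretic matrix multiplication; companion of
`CohnUmansTPP.lean` (`RealizesTPP`), `TPPGroupExtension.lean` (Cohn–Umans 2003 Lemma 2.2) and
`PseudoExponentBounds.lean` (`S₃` realizes `⟨2,2,2⟩`)).

I. Hedtke, S. Murthy, *Search and test algorithms for triple product property triples*, Groups Complex.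
Cryptol. 4 (2012), doi:10.1515/gcc-2012-0006 = arXiv:1104.5097, §4, Lemma 4.1 (held text
`paper:arxiv-1104.5097` chunk p0008 L8–13), verbatim:

> **Lemma 4.1.** If `G` is a nonabelian group with a nonnormal subgroup `S` of index `[G:S] = 3`, then
> `β(G) ≥ (4/3) |G|`.
> *Proof.* Let `S\G` be the right coset space of `G` of size `[G:S] = 3`. There is a natural homomorphism
> `φ : G → S₃` […] The homomorphism `φ` has a kernel `K := ker φ ⊴ G`, which is `Core_G(S)` […]. The
> quotient group `G/K ≅ img φ ≤ S₃` is isomorphic to a transitive subgroup in `S₃`. The nontrivial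
> transitive subgroups of `S₃` are `A₃` and `S₃` itself. Since `S` is nonnormal, `K < S` is proper and so
> `|G/K| > 3`. Thus `G/K ≅ S₃`. From [Cohn] we know that `β(G) ≥ β(G/K) β(K)`. It follows (see table
> (tab:small)), that `β(G) ≥ 8 β(K) ≥ 8|K| = 8|G|/|G/K| = (8/6)|G| = (4/3)|G|. □
> ("The ideas behind the proofs are those of the authors, but the proofs as formulated here are those
> of Neumann.")

Here `β(G) = max {|S||T||U| : (S, T, U) a TPP triple of G}` is the TPP capacity; the tree has no `β`
symbol, so the lemma is rendered as the existence of a realization `⟨2|K|, 2, 2⟩` (`K = Core_G(S)`,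
`|G| = 6|K|`) — i.e. a TPP triple with `|S||T||U| = 8|K| = (4/3)|G|` exactly — following the printed proof
step by step: `G/K ↪ Sym(G/S) ≅ S₃` (Mathlib `MulAction.toPermHom`, `Subgroup.normalCore_eq_ker`),
`[G : K] = 6` (it divides `3! = 6` and is a proper multiple of `3`), hence `G/K ≅ S₃`, which realizes
`⟨2,2,2⟩` (the paper reads `β(S₃) = 8` off its Table (tab:small); here Cohn–Umans 2003 §3's `S₃` example, tree
`realizesTPP_perm_fin_three`), `K` realizes
`⟨|K|,1,1⟩` (tree `realizesTPP_one_one_card`), and Cohn–Umans 2003 Lemma 2.2 (tree `CohnUmans2003_lemma22`,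
the paper's "[Cohn]: `β(G) ≥ β(G/K) β(K)`") multiplies them.  The printed hypothesis "nonabelian" is implied by
the existence of a non-normal subgroup and is not repeated.

## What is here (all proved; 0 definitions, 0 named facts)

* `index_normalCore_eq_six_of_index_three` — `[G : S] = 3`, `S` not normal ⇒ `[G : Core_G(S)] = 6`;
* `realizesTPP_two_two_two_quotient_normalCore` — then `G / Core_G(S) ≅ S₃` realizes `⟨2, 2, 2⟩`;
* `HedtkeMurthy2012_lemma41` — **Lemma 4.1**: `G` realizes `⟨2|K|, 2, 2⟩` with `K = Core_G(S)` and
  `|G| = 6|K|`, so `3 · (2|K| · 2 · 2) = 4|G|` (`HedtkeMurthy2012_lemma41'`: `∃` a realization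
  `⟨n, m, p⟩` with `3 nmp = 4|G|`, i.e. `β(G) ≥ 4|G|/3`).

## References
* I. Hedtke, S. Murthy, arXiv:1104.5097 = Groups Complex. Cryptol. 4 (2012): Lemma 4.1 with proof (after
  P. M. Neumann), §4. [HedtkeMurthy2012]
* H. Cohn, C. Umans, FOCS 2003, arXiv:math/0307321: Lemma 2.2; §3 (`S₃` realizes `⟨2,2,2⟩`). [CohnUmans2003]
-/

namespace Literature.Computability.AlgebraicComplexity

open Literature.Combinatorics.Additive

variable {G : Type*} [Group G]

/-- If `S ≤ G` has index `3` and is not normal, its normal core `K = Core_G(S)` has index `6`: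
`[G : K]` divides `[G : S]! = 6` (`G/K ↪ Sym(G/S)`), is a multiple of `3`, and is not `3` (else
`K = S` would be normal). [folklore] (the step "`|G/K| > 3`. Thus `G/K ≅ S₃`" of
[cite: HedtkeMurthy2012, Lemma 4.1 (proof)]) -/
theorem index_normalCore_eq_six_of_index_three (S : Subgroup G) (hS : S.index = 3)
    (hSn : ¬ S.Normal) : S.normalCore.index = 6 := by
  haveI : S.FiniteIndex := ⟨by rw [hS]; decide⟩
  -- `[G : K] ∣ 3! = 6`
  have hdvd : S.normalCore.index ∣ Nat.factorial S.index := by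
    rw [Subgroup.normalCore_eq_ker, Subgroup.index_ker, Subgroup.index_eq_card, ← Nat.card_perm]
    exact Subgroup.card_subgroup_dvd_card (MulAction.toPermHom G (G ⧸ S)).range
  rw [hS] at hdvd
  -- `[G : K] = [S : K] · 3` with `[S : K] ≠ 1`
  have hmul : S.normalCore.relIndex S * 3 = S.normalCore.index := by
    rw [← hS]
    exact Subgroup.relIndex_mul_index S.normalCore_le
  have hr1 : S.normalCore.relIndex S ≠ 1 := by
    intro h1
    apply hSn
    have hle : S ≤ S.normalCore := Subgroup.relIndex_eq_one.1 h1
    have heq : S.normalCore = S := le_antisymm S.normalCore_le hle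
    rw [← heq]
    exact S.normalCore_normal
  -- so `[S : K] · 3 ∣ 6`, `[S : K] ∣ 2`, `[S : K] = 2`
  have h6 : Nat.factorial 3 = 6 := by decide
  rw [h6, ← hmul] at hdvd
  have hr2 : S.normalCore.relIndex S ∣ 2 := by
    have : S.normalCore.relIndex S * 3 ∣ 2 * 3 := hdvd
    exact (Nat.mul_dvd_mul_iff_right (by norm_num : 0 < 3)).1 this
  have hr : S.normalCore.relIndex S = 2 := by
    rcases (Nat.dvd_prime Nat.prime_two).1 hr2 with h | h
    · exact absurd h hr1
    · exact h
  rw [← hmul, hr]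

/-- If `S ≤ G` has index `3` and is not normal, then `G / Core_G(S)` (`≅ S₃`, onto which it maps
injectively by the action on the three cosets of `S`, both groups having order `6`) realizes `⟨2, 2, 2⟩`.
[cite: HedtkeMurthy2012, Lemma 4.1 (proof)] [cite: CohnUmans2003, §3 (`S₃` realizes `⟨2,2,2⟩`)] -/
theorem realizesTPP_two_two_two_quotient_normalCore [Finite G] (S : Subgroup G) (hS : S.index = 3)
    (hSn : ¬ S.Normal) : RealizesTPP (G ⧸ S.normalCore) 2 2 2 := by
  classical
  have h6 := index_normalCore_eq_six_of_index_three S hS hSn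
  -- the faithful action of `G/K` on `G/S`, and `G/S ≃ Fin 3`
  let φ : G →* Equiv.Perm (G ⧸ S) := MulAction.toPermHom G (G ⧸ S)
  letI : Fintype (G ⧸ S) := Fintype.ofFinite _
  have hcardS : Fintype.card (G ⧸ S) = 3 := by
    rw [← Nat.card_eq_fintype_card, ← Subgroup.index_eq_card, hS]
  let e : G ⧸ S ≃ Fin 3 := Fintype.equivFinOfCardEq hcardS
  let ψ : G ⧸ S.normalCore →* Equiv.Perm (Fin 3) :=
    (e.permCongrHom.toMonoidHom.comp (QuotientGroup.kerLift φ)).comp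
      (QuotientGroup.quotientMulEquivOfEq (Subgroup.normalCore_eq_ker S)).toMonoidHom
  have hψ : Function.Injective ψ := by
    refine (e.permCongrHom.injective.comp (QuotientGroup.kerLift_injective φ)).comp ?_
    exact (QuotientGroup.quotientMulEquivOfEq (Subgroup.normalCore_eq_ker S)).injective
  -- equal orders `6`, so `ψ` is an isomorphism
  have hcardQ : Nat.card (G ⧸ S.normalCore) = 6 := by rw [← Subgroup.index_eq_card, h6]
  have hcardP : Nat.card (Equiv.Perm (Fin 3)) = 6 := by
    rw [Nat.card_perm, Nat.card_eq_fintype_card, Fintype.card_fin]; rfl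
  have hbij : Function.Bijective ψ := by
    rw [Nat.bijective_iff_injective_and_card]
    exact ⟨hψ, by rw [hcardQ, hcardP]⟩
  let E : (G ⧸ S.normalCore) ≃* Equiv.Perm (Fin 3) := MulEquiv.ofBijective ψ hbij
  exact realizesTPP_perm_fin_three.map_of_injective E.symm.toMonoidHom E.symm.injective

/-- **Hedtke–Murthy 2012, Lemma 4.1** ("If `G` is a nonabelian group with a nonnormal subgroup `S` of
index `[G:S] = 3`, then `β(G) ≥ (4/3)|G|`"), in the explicit form of its printed proof: with
`K = Core_G(S)` one has `|G| = 6|K|` and `G` realizes `⟨2|K|, 2, 2⟩` (Cohn–Umans Lemma 2.2 applied to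
`K ⊴ G`, which realizes `⟨|K|, 1, 1⟩`, and `G/K ≅ S₃`, which realizes `⟨2, 2, 2⟩`), a TPP triple of size
`8|K| = (4/3)|G|`. [cite: HedtkeMurthy2012, Lemma 4.1] -/
theorem HedtkeMurthy2012_lemma41 [Finite G] (S : Subgroup G) (hS : S.index = 3) (hSn : ¬ S.Normal) :
    RealizesTPP G (2 * Nat.card S.normalCore) 2 2 ∧ Nat.card G = 6 * Nat.card S.normalCore := by
  classical
  have h6 := index_normalCore_eq_six_of_index_three S hS hSn
  refine ⟨?_, by rw [← h6, mul_comm, Subgroup.card_mul_index]⟩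
  letI : Fintype S.normalCore := Fintype.ofFinite _
  have hK : RealizesTPP S.normalCore (Nat.card S.normalCore) 1 1 := by
    rw [Nat.card_eq_fintype_card]
    exact (realizesTPP_one_one_card (G := S.normalCore)).rotate.rotate
  have h := CohnUmans2003_lemma22 S.normalCore hK
    (realizesTPP_two_two_two_quotient_normalCore S hS hSn)
  simpa only [one_mul, mul_comm (Nat.card S.normalCore) 2] using h

/-- **Hedtke–Murthy 2012, Lemma 4.1**, capacity form: a finite group with a non-normal subgroup of
index `3` realizes some `⟨n, m, p⟩` with `n m p = (4/3)|G|` (so `β(G) ≥ (4/3)|G|`).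
[cite: HedtkeMurthy2012, Lemma 4.1] -/
theorem HedtkeMurthy2012_lemma41' [Finite G] (S : Subgroup G) (hS : S.index = 3) (hSn : ¬ S.Normal) :
    ∃ n m p : ℕ, RealizesTPP G n m p ∧ 3 * (n * m * p) = 4 * Nat.card G := by
  obtain ⟨h, hcard⟩ := HedtkeMurthy2012_lemma41 S hS hSn
  exact ⟨_, _, _, h, by rw [hcard]; ring⟩

end Literature.Computability.AlgebraicComplexity
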